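import Literature.NumberTheory.LFunctions.DirichletLTruncationPackedCells
import Literature.NumberTheory.LFunctions.DirichletLTruncationPackedFrame
import Literature.NumberTheory.LFunctions.DirichletLTruncationPackedLeafCell
import Literature.NumberTheory.LFunctions.DirichletLTruncationPackedLeafCells
import Literature.NumberTheory.LFunctions.DirichletLTruncationPackedSeg
import Literature.NumberTheory.LFunctions.DirichletLTruncationCertificatesOdd
import HarnessLib

/-!
# Packed truncation certificates — soundness

**Theorem.** For a primitive quadratic character `χ` mod `q` with integer values `v` and sign tables `PM`, if the frame
certificate `certTframe` passes on the union of the cell groups and every group passes `certTcells`, then `L(σ, χ) ≠ 0` for all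
`σ ∈ (0, 1)` (Chua's ALGO 1 evaluated by Kronecker-packed arithmetic on a graded mesh). Assembles the landed pieces:
`seg_spec`/`leafCells_spec`/`leafCell_spec_A/D` (the per-cell invariant), `exists_cell_of_covers`, `cellOK_sound`,
`LTruncation.cell_bound`, `uwalk_spec`, `LTruncationCert.lfunction_ne_zero_of_truncation_drift`. [cite: Chua2005RealZeros, §2.2 ALGO 1]
-/

namespace Literature.NumberTheory.LFunctions

namespace LTruncationPacked

open Finset FeketePolyaKernel LTruncationCert LTruncation DirichletAbel Literature.Analysis.Convolution

section Sound

variable {q : ℕ} [NeZero q] {χ : DirichletCharacter ℂ q} {v : ℕ → ℤ}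

omit [NeZero q] in
/-- Values of a quadratic character are `0, ±1`. [folklore] -/
private theorem val3 (hquad : χ.IsQuadratic) (hv : ∀ n : ℕ, (χ (n : ZMod q)).re = v n) (n : ℕ) :
    v n = 0 ∨ v n = 1 ∨ v n = -1 := by
  have h := hv n
  rcases hquad (n : ZMod q) with h0 | h1 | h2
  · rw [h0, Complex.zero_re] at h; left; exact_mod_cast h.symm
  · rw [h1, Complex.one_re] at h; right; left; exact_mod_cast h.symm
  · rw [h2, Complex.neg_re, Complex.one_re] at h; right; right; exact_mod_cast h.symm

omit [NeZero q] in
/-- `ℜ S(N) = Sv N`. [folklore] -/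
private theorem re_S (hv : ∀ n : ℕ, (χ (n : ZMod q)).re = v n) : ∀ N : ℕ, (partialSum χ N).re = (Sv v N : ℝ) := by
  intro N
  induction N with
  | zero => simp [Sv]
  | succ N ih => rw [partialSum_succ, Complex.add_re, ih, hv, Sv]; push_cast; ring

omit [NeZero q] in
/-- `ℜ U(N) = Uv N`. [folklore] -/
private theorem re_U (hv : ∀ n : ℕ, (χ (n : ZMod q)).re = v n) :
    ∀ N : ℕ, (∑ k ∈ range N, partialSum χ (k + 1)).re = (Uv v N : ℝ) := by
  intro N
  induction N with
  | zero => simp [Uv]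
  | succ N ih => rw [Finset.sum_range_succ, Complex.add_re, ih, re_S hv, Uv]; push_cast; ring

/-- The bisection invariant (private copy). [folklore] -/
private theorem bisect_spec₃ (pred : ℕ → Bool) : ∀ (fuel xl xh : ℕ), pred xl = true → pred xh = false →
    pred (bisect pred fuel xl xh).1 = true ∧ pred (bisect pred fuel xl xh).2 = false := by
  intro fuel
  induction fuel with
  | zero => intro xl xh h1 h2; exact ⟨h1, h2⟩
  | succ fuel ih =>
    intro xl xh h1 h2
    simp only [bisect]
    split_ifs with hlt hmid
    · exact ih _ _ hmid h2
    · exact ih _ _ h1 (by simpa using hmid)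
    · exact ⟨h1, h2⟩

/-- Lookup in `cellsOK` along an aligned invariant. [folklore] -/
private theorem cellsOK_lookup {P E M r Bm loM : ℕ} (Inv : (ℕ × ℕ) → (ℤ × ℕ) → Prop) :
    ∀ (cells : List (ℕ × ℕ)) (st : List (ℤ × ℕ)), List.Forall₂ Inv cells st →
      cellsOK P E M r Bm loM cells st = true → ∀ c ∈ cells, ∃ ad, cellOK P E M r Bm loM c ad = true ∧ Inv c ad := by
  intro cells st h
  induction h with
  | nil => intro _ c hc; simp at hc
  | cons hab htl ih =>
    intro hok c hc
    rename_i a b' l₁ l₂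
    simp only [cellsOK, Bool.and_eq_true] at hok
    rcases List.mem_cons.1 hc with rfl | hc'
    · exact ⟨b', hok.1, hab⟩
    · exact ih hok.2 c hc'

/-- The initial state satisfies the invariant at `n₀ = 1` (empty sums). [folklore] -/
private theorem forall₂_init {P E : ℕ} (cells : List (ℕ × ℕ)) :
    List.Forall₂ (CellInv P E v 1) cells (cells.map fun _ => ((0 : ℤ), (0 : ℕ))) := by
  induction cells with
  | nil => exact List.Forall₂.nil
  | cons c rest ih =>
    refine List.Forall₂.cons ?_ ih
    constructor <;> simp [Asum, Dsum]

omit [NeZero q] in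
/-- **Soundness of one cell group**: if `certTcells` passes, every `σ` in one of its cells satisfies the truncation inequality `hP`.
[cite: Chua2005RealZeros, §2.2 ALGO 1] -/
theorem hP_of_certTcells (hquad : χ.IsQuadratic) (hv : ∀ n : ℕ, (χ (n : ZMod q)).re = v n)
    {b P J G K Bm : ℕ} {PM : ℕ × ℕ} (htab : IsSignTab b q v PM) {g : List (ℕ × ℕ)}
    (hg : certTcells b P J G q K Bm g PM = true) {σ : ℝ}
    {c : ℕ × ℕ} (hc : c ∈ g) (hc1 : (c.1 : ℝ) ≤ σ * (2 ^ J : ℕ)) (hc2 : σ * (2 ^ J : ℕ) ≤ (c.1 : ℝ) + c.2) :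
    7 ≤ q ∧ 1 ≤ K ∧ 0 < isqrtSucc (K * q) ∧ isqrtSucc (K * q) * isqrtSucc (K * q) ≤ K * q + 1 ∧
    (Bm : ℝ) / (2 * (isqrtSucc (K * q)) * (K * q + 1 : ℕ)) <
      ∑ n ∈ range (K * q), (χ ((n + 1 : ℕ) : ZMod q)).re * ((n + 1 : ℕ) : ℝ) ^ (-σ) := by
  have hv3 := val3 hquad hv
  simp only [certTcells, Bool.and_eq_true, Nat.ble_eq, Nat.one_shiftLeft] at hg
  obtain ⟨⟨⟨⟨hq7, hK⟩, hJ⟩, hb⟩, hrest⟩ := hg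
  set M := K * q with hM
  set E := 2 ^ J with hEdef
  have hE : 1 ≤ E := Nat.one_le_two_pow
  have hM1 : 1 ≤ M := le_trans (by omega) (Nat.le_mul_of_pos_left q hK)
  -- the tables over `[1, M]`
  have hper : ∀ s, v (s % q) = v s := fun s => by
    have h1 := hv (s % q); have h2 := hv s
    have : ((s % q : ℕ) : ZMod q) = (s : ZMod q) := by simp [ZMod.natCast_mod]
    rw [this] at h1; exact_mod_cast h1.symm.trans h2
  have hN : q * (K + 1) / q = K + 1 := by rw [Nat.mul_div_cancel_left _ (by omega)]
  have htabN := isSignTab_pext (N := q * (K + 1)) (by omega) (by omega) (Dvd.intro _ rfl) htab hper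
  rw [hN] at htabN
  obtain ⟨hP1, hP2⟩ := htabN
  simp only at hP1 hP2
  have hMle : M + 1 ≤ q * (K + 1) := by rw [hM]; nlinarith
  have h2b : 1 < 2 ^ b := Nat.one_lt_two_pow (by omega)
  have hdig1 : ∀ j < M + 1, ind (v j = 1) < 2 ^ b := fun j _ => by
    rw [ind]; split_ifs <;> omega
  have hdig2 : ∀ j < M + 1, ind (v j = -1) < 2 ^ b := fun j _ => by
    rw [ind]; split_ifs <;> omega
  have hTP : (pextS b q (K + 1) PM.1 &&& (2 ^ (b * (M + 1)) - 1)) >>> b = kpack b M fun t => ind (v (1 + t) = 1) := by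
    rw [hP1, kpack_land_low hMle hdig1, show M + 1 = 1 + M by omega,
      show (kpack b (1 + M) fun n => ind (v n = 1)) >>> b = (kpack b (1 + M) fun n => ind (v n = 1)) >>> (b * 1) by
        rw [mul_one], kpack_shiftRight_high (fun j _ => hdig1 j (by omega))]
  have hTM : (pextS b q (K + 1) PM.2 &&& (2 ^ (b * (M + 1)) - 1)) >>> b = kpack b M fun t => ind (v (1 + t) = -1) := by
    rw [hP2, kpack_land_low hMle hdig2, show M + 1 = 1 + M by omega,
      show (kpack b (1 + M) fun n => ind (v n = -1)) >>> b = (kpack b (1 + M) fun n => ind (v n = -1)) >>> (b * 1) by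
        rw [mul_one], kpack_shiftRight_high (fun j _ => hdig2 j (by omega))]
  rw [hTP, hTM] at hrest
  -- the walk
  rcases hseg : seg b P J G g 24 1 M (kpack b M fun t => ind (v (1 + t) = 1)) (kpack b M fun t => ind (v (1 + t) = -1))
      (g.map fun _ => ((0 : ℤ), (0 : ℕ))) with _ | st
  · rw [hseg] at hrest; simp at hrest
  rw [hseg] at hrest
  simp only at hrest
  -- the invariant through the walk
  have hleaf : ∀ (n₀ L : ℕ) (st st' : List (ℤ × ℕ)), 1 ≤ n₀ → 1 ≤ L →
      List.Forall₂ (CellInv P E v n₀) g st →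
      leaf b P J n₀ L (kpack b L fun t => ind (v (n₀ + t) = 1)) (kpack b L fun t => ind (v (n₀ + t) = -1)) g st = some st' →
      List.Forall₂ (CellInv P E v (n₀ + L)) g st' := by
    intro n₀ L st st' hn₀ hL hinv hl
    have hx1 : 1 ≤ n₀ + L - 1 := by omega
    have hxm : 1 ≤ n₀ + (L - 1) / 2 := by omega
    refine leafCells_spec (b := b) (P := P) (E := E) (J := J) hEdef
      (leafData b P J n₀ L (kpack b L (sgnP v n₀)) (kpack b L (sgnM v n₀))) hn₀ hx1 hxm
      (lowRoots_spec P hn₀ hJ).2 (upRoots_spec P hn₀ hJ).2 (upRoots_spec P hx1 hJ).2 (lowRoots_spec P hxm hJ).2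
      (CellInv P E v n₀) (CellInv P E v (n₀ + L)) ?_ g st 0 (2 ^ P) (2 ^ P) (2 ^ P) (2 ^ P) ?_ ?_ ?_ ?_ hinv st' hl
    · intro i w c0l c0h c1h cml pref d pref' d' h1 h2 h3 h4 hI hcell
      exact ⟨leafCell_spec_A hv3 hE hn₀ hL h1 h2 h3 h4 hI.1 hcell, leafCell_spec_D hv3 hE hn₀ hL h2 h4 hI.1 hI.2 hcell⟩
    all_goals simp
  have hinvM := seg_spec (b := b) (P := P) (J := J) (G := G) (by omega) (dP := fun n => ind (v n = 1))
    (dM := fun n => ind (v n = -1)) (fun n => by simp only [ind]; split_ifs <;> simp)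
    (fun n => by simp only [ind]; split_ifs <;> simp) g (CellInv P E v) hleaf 24 1 M _ st le_rfl (forall₂_init g) hseg
  -- the cell
  obtain ⟨⟨a, d⟩, hok, hI⟩ := cellsOK_lookup (CellInv P E v (1 + M)) g st hinvM hrest c hc
  obtain ⟨i, w⟩ := c
  obtain ⟨hIA, hID⟩ := hI
  simp only [show 1 + M - 1 = M by omega] at hIA hID
  -- `r`
  set r := isqrtSucc M with hr
  have hr0 : 0 < r := by
    by_contra h0
    have : r = 0 := by omega
    simp [cellOK, this] at hok
  have hrq : r * r ≤ M + 1 := by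
    have := (bisect_spec₃ (fun r ↦ decide (r * r ≤ M + 1)) (M + 2) 0 (M + 2) (by simp)
      (by simp only [decide_eq_false_iff_not, not_le]; nlinarith)).1
    rw [hr, isqrtSucc]
    simpa using this
  refine ⟨hq7, hK, hr0, hrq, ?_⟩
  -- the real inequality
  set s₀ : ℝ := (i : ℝ) / E with hs₀
  set u : ℝ := σ - s₀ with hu
  have hE0 : (0 : ℝ) < E := by exact_mod_cast hE
  simp only at hc1 hc2
  have hu0 : 0 ≤ u := by rw [hu, hs₀, sub_nonneg, div_le_iff₀ hE0]; exact hc1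
  have huw : u ≤ (w : ℝ) / E := by
    rw [hu, hs₀, sub_le_iff_le_add, ← add_div, le_div_iff₀ hE0]; linarith
  have hlo := (rootEnc_spec P hM1 hE).1
  obtain ⟨hA0, hineq⟩ := cellOK_sound hE hM1 hok hIA hID hlo huw
  have hcell := LTruncation.cell_bound (fun n ↦ (v (n + 1) : ℝ)) M s₀ hu0 huw
  have hDmono : Dsum v s₀ (M - 1) ≤ Dsum v s₀ M := by
    rw [Dsum, Dsum, show M = (M - 1) + 1 by omega, Finset.sum_range_succ, show M - 1 + 1 - 1 = M - 1 by omega]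
    have : 0 ≤ max 0 (-(Asum v s₀ (M - 1 + 1))) / ((M - 1 + 1 : ℕ) : ℝ) := by positivity
    linarith
  have hsum_eq : ∑ n ∈ range M, (χ ((n + 1 : ℕ) : ZMod q)).re * ((n + 1 : ℕ) : ℝ) ^ (-σ) =
      ∑ n ∈ range M, (v (n + 1) : ℝ) * ((n + 1 : ℕ) : ℝ) ^ (-(s₀ + u)) := by
    refine Finset.sum_congr rfl fun n _ => ?_
    rw [hv, show s₀ + u = σ by rw [hu]; ring]
  rw [hsum_eq]
  refine lt_of_lt_of_le ?_ hcell
  have hw0 : (0 : ℝ) ≤ (w : ℝ) / E := by positivity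
  have hAM : Asum v s₀ M * (M : ℝ) ^ (-u) - (w : ℝ) / E * Dsum v s₀ M ≤
      (∑ n ∈ range M, (v (n + 1) : ℝ) * ((n + 1 : ℕ) : ℝ) ^ (-s₀)) * ((M : ℕ) : ℝ) ^ (-u) -
        (w : ℝ) / E * ∑ i ∈ range (M - 1), max 0 (-(∑ n ∈ range (i + 1), (v (n + 1) : ℝ) * ((n + 1 : ℕ) : ℝ) ^ (-s₀))) /
          ((i + 1 : ℕ) : ℝ) := by
    have h1 : (∑ n ∈ range M, (v (n + 1) : ℝ) * ((n + 1 : ℕ) : ℝ) ^ (-s₀)) = Asum v s₀ M := rfl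
    have h2 : (∑ i ∈ range (M - 1), max 0 (-(∑ n ∈ range (i + 1), (v (n + 1) : ℝ) * ((n + 1 : ℕ) : ℝ) ^ (-s₀))) /
        ((i + 1 : ℕ) : ℝ)) = Dsum v s₀ (M - 1) := rfl
    rw [h1, h2]
    have := mul_le_mul_of_nonneg_left hDmono hw0
    linarith
  linarith

/-- **Soundness of the packed truncation certificate.** [cite: Chua2005RealZeros, §2.2 ALGO 1] -/
theorem lfunction_ne_zero_of_certT (hprim : χ.IsPrimitive) (hquad : χ.IsQuadratic)
    (hv : ∀ n : ℕ, (χ (n : ZMod q)).re = v n) {b e P J G K Bm : ℕ} {PM : ℕ × ℕ} (htab : IsSignTab b q v PM)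
    (groups : List (List (ℕ × ℕ))) (hne : groups ≠ [])
    (hframe : certTframe b e J q Bm groups.flatten PM = true)
    (hcells : ∀ g ∈ groups, certTcells b P J G q K Bm g PM = true) :
    ∀ σ : ℝ, 0 < σ → σ < 1 → χ.LFunction (σ : ℂ) ≠ 0 := by
  have hv3 := val3 hquad hv
  simp only [certTframe, Bool.and_eq_true, Nat.ble_eq, Nat.blt_eq, Nat.one_shiftLeft] at hframe
  obtain ⟨⟨⟨⟨⟨hq7, hJ⟩, hb⟩, hBm⟩, hcov⟩, hwalk⟩ := hframe
  -- facts from the first group (q ≥ 7, K ≥ 1, r)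
  obtain ⟨g0, hg0⟩ := List.exists_mem_of_ne_nil groups hne
  -- the U-walk
  haveI : Fact (1 < q) := ⟨by omega⟩
  have hv0 : v 0 = 0 := by
    have h := hv 0
    rw [Nat.cast_zero, MulChar.map_zero, Complex.zero_re] at h
    exact_mod_cast h.symm
  have hvq : v q = 0 := by
    have h := hv q
    rw [ZMod.natCast_self, MulChar.map_zero, Complex.zero_re] at h
    exact_mod_cast h.symm
  rcases hw : walkD b (Bm + 1) e q (PM.1 + Bm <<< b) (PM.2 + Bm <<< (2 * b)) [0, 0] with _ | st
  · rw [hw] at hwalk; simp at hwalk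
  rw [hw] at hwalk
  match st, hwalk, hw with
  | [s1, u2], hwalk, hw =>
    simp only [decide_eq_true_eq] at hwalk
    have hBm' : Bm + 1 < 2 ^ b := by
      have h4 : 2 ^ b = 2 ^ (b - 2) * 2 ^ 2 := by rw [← pow_add, Nat.sub_add_cancel (by omega : 2 ≤ b)]
      have : 1 ≤ 2 ^ (b - 2) := Nat.one_le_two_pow
      have h22 : (2 : ℕ) ^ 2 = 4 := by norm_num
      rw [h22] at h4
      omega
    obtain ⟨hU, hfin⟩ := uwalk_spec Bm hv3 hv0 (by omega) hBm' (by omega) htab hw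
    have hUq : 0 ≤ (∑ k ∈ range q, partialSum χ (k + 1)).re := by
      rw [re_U hv]
      have : Uv v q = Uv v (q - 1) + Sv v (q - 1) := by
        rw [show q = (q - 1) + 1 by omega, Uv, Sv, show q - 1 + 1 = q by omega, hvq]; ring
      have h2 : (0 : ℤ) ≤ Uv v q := by rw [this, ← hfin]; exact hwalk
      exact_mod_cast h2
    have hUN : ∀ N, N < q → -(Bm : ℝ) ≤ (∑ k ∈ range N, partialSum χ (k + 1)).re := by
      intro N hN; rw [re_U hv]; exact_mod_cast hU N hN
    -- data from the first group, then `hP` from the group of the cell of `σ`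
    have hE : 1 ≤ 2 ^ J := Nat.one_le_two_pow
    have hχ1 : χ ≠ 1 := SelbergDirichlet.ne_one_of_isPrimitive (by omega) hprim
    -- pick any σ₀ to extract `K ≥ 1`, `r`: use σ₀ = 1/2 ... we need them uniformly; take them from the cell of σ = 1/2
    obtain ⟨c₀, hc₀, hc₀1, hc₀2⟩ := exists_cell_of_covers hE hcov (σ := 1 / 2) le_rfl (by norm_num)
    obtain ⟨g₁, hg₁, hc₀g⟩ := List.mem_flatten.1 hc₀
    obtain ⟨-, hK, hr0, hrq, -⟩ := hP_of_certTcells hquad hv htab (hcells g₁ hg₁) hc₀g hc₀1 hc₀2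
    refine lfunction_ne_zero_of_truncation_drift χ hprim hχ1 hq7 hK hUq (Nat.cast_nonneg Bm) hUN hr0 hrq
      fun σ hσ1 hσ2 ↦ ?_
    obtain ⟨c, hc, hc1, hc2⟩ := exists_cell_of_covers hE hcov hσ1 hσ2
    obtain ⟨g, hg, hcg⟩ := List.mem_flatten.1 hc
    exact (hP_of_certTcells hquad hv htab (hcells g hg) hcg hc1 hc2).2.2.2.2
  | [], hwalk, _ => simp at hwalk
  | [_], hwalk, _ => simp at hwalk
  | _ :: _ :: _ :: _, hwalk, _ => simp at hwalk

end Sound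

end LTruncationPacked

end Literature.NumberTheory.LFunctions
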